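import Mathlib
import Summits.Ventures.PercRepro2.Defs
import Summits.Ventures.PercRepro2.Graph
import Summits.Ventures.PercRepro2.Induced
import Summits.Ventures.PercRepro2.GateDefs

/-!
# (LIN-D): the finest hull-frame linearisation of the free one-sided gate (blind cell PercRepro2,
mine-c g7, MINE-C.md §14.1–14.2, proofs/MINEC-LIND.md)

Root `s`, avoided set `T` (hull `K = ⋃_{t ∈ T} C(t)`), markers `a, b`, gate vertices `u, w`
(free: `u, w ∉ T ∪ {s, a, b}`). The one-sided gate (ARC u ⇐ w) is `Gate.GateRow s T a b {u} {w}`: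
`Φ(R_T ∖ {u ∈ S, w ∈ K}) ≥ 0`. Reading `H` as a symmetric coin system and adding ONE arc `u → w`,
the gate event is `{s ∉ Z}` for the **backward cluster** `Z` of `T` in `H + (u → w)`:
`Z = K`, or `Z = K ∪ C_{H ∖ K}(u)` when `w ∈ K`. Given `Z`, the configuration on `H ∖ Z` is product,
so `x_Z := P_{H ∖ Z}(s ↔ a)` (`delClusterProb`) is the conditional marker probability, decreasing in `Z`.

**(LIN-D)** is the Rao–Blackwell form of the gate on `σ(Z)` with the *H*-centring `m = E[· | R_T]`:

  `E[(x_Z − m_X)(y_Z − m_Y); s ∉ Z] ≥ 0`,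

cleared by `P(R_T)²`:  `E[ 1_{gate} · (x_Z · P(R_T) − P(X; R_T)) · (y_Z · P(R_T) − P(Y; R_T)) ] ≥ 0`.

* (LIN-D) ⟹ (ARC): `Φ(gate) = (LIN-D) + E[Cov_{H ∖ Z}(X, Y); gate]` and the inner covariances are
  Harris covariances in the product measure on `H ∖ Z` (≥ 0). It is the un-merged analogue of the
  cell's (L1-K) for the merged rung (the e-open hull and the e-open unconditioned `x₁(K)`).
* Equivalently `Cov_{λ_D}(x_Z, y_Z) ≥ −Δ_X Δ_Y` with `λ_D` the law of `Z` given the gate (a directed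
  BHK law: the covariance is ≥ 0) and `Δ = E[· | gate] − E[· | R_T]`: the content is the
  disagreeing-shift regime.
* Census (mine-c g7, exact): `n = 6` ALL 112 graphs × 3 palette vectors × all 360 free tuples
  0 / 120,960 (24,468 ties); `n = 7` every 7th graph × `p = ½` × all 2,520 free tuples 0 / 307,440;
  `n = 7` every 13th × (½ + palette) 0 / 332,640; (1+1)-ES in logit space 240 climbs, 134k
  evaluations, 0 exact negatives, every climb an exact tie. The u-first linearisation (reveal
  `C_{H ∖ u}(s)`) is FALSE (91 / 120,960): the gate is a hull-frame statement.
-/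

namespace Summit.Ventures.PercRepro2

namespace LinD

variable {V : Type*} {E : Type*}

section Sets

variable (ends : E → Sym2 V) (T : Finset V) (u w : V)

/-- The hull `K = ⋃_{t ∈ T} C(t)` of the avoided set, as a set of vertices. -/
def hull (ω : Config E) : Set V := {v | ∃ t ∈ T, Conn ends ω t v}

open Classical in
/-- The **backward cluster** of `T` in the digraph `H + (u → w)`: the hull, with the cluster of `u`
in `H ∖ K` attached when the arc's head `w` lies in the hull (then every vertex that reaches `u`
reaches `T` through the arc). -/
noncomputable def backCluster (ω : Config E) : Set V :=
  hull ends T ω ∪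
    (if w ∈ hull ends T ω then cluster ends (delConfig ends (hull ends T ω) ω) u else ∅)

/-- The hull is contained in the backward cluster. -/
lemma hull_subset_backCluster (ω : Config E) : hull ends T ω ⊆ backCluster ends T u w ω :=
  Set.subset_union_left

end Sets

section Row

variable [Fintype E] [DecidableEq E] [DecidableEq V] {R : Type*} [Field R] [LinearOrder R]

variable (p : E → R) (ends : E → Sym2 V) (s : V) (T : Finset V) (a u w : V)

/-- `x_Z = P_{H ∖ Z}(a ∈ C(s))` for the backward cluster `Z = Z(ω)`: the conditional probability of
the marker event given the explored backward cluster (product measure on `H ∖ Z`). -/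
noncomputable def xZ (ω : Config E) : R :=
  delClusterProb p ends s {W | a ∈ W} (backCluster ends T u w ω)

end Row

section Statement

variable [Fintype E] [DecidableEq E] [DecidableEq V] {R : Type*} [Field R] [LinearOrder R]

variable (p : E → R) (ends : E → Sym2 V) (s : V) (T : Finset V) (a b u w : V)

/-- **(LIN-D)**, cleared by `P(R_T)²`:
`E[ 1_{gate_{u,w}} · (x_Z P(R_T) − P(a ∈ S; R_T)) · (y_Z P(R_T) − P(b ∈ S; R_T)) ] ≥ 0`,
the finest hull-frame linearisation of the one-sided gate (ARC u ⇐ w) (mine-c g7 §14). -/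
def LinDRow : Prop :=
  0 ≤ expect p (fun ω =>
        (Gate.gateEvent ends s T {u} {w}).indicator (fun _ => (1 : R)) ω *
          (xZ p ends s T a u w ω * prob p (avoidAll ends s T) -
            prob p (connAll ends s {a} ∩ avoidAll ends s T)) *
          (xZ p ends s T b u w ω * prob p (avoidAll ends s T) -
            prob p (connAll ends s {b} ∩ avoidAll ends s T)))

end Statement

section Closure

variable (R : Type*) [Field R] [LinearOrder R] [IsStrictOrderedRing R]

/-- **(LIN-D) over all finite graphs**, admissible weights, roots `s ∉ T`, markers `a, b` and gate
vertices `u, w ∉ T ∪ {s}` (the free case `u, w ∉ {a, b}` is the open content; `u = a` and `w = b` are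
the marker gates). Implies `Gate.GateRow_all` restricted to singleton gates. -/
def LinDRow_all : Prop :=
  ∀ (V E : Type) [Fintype V] [DecidableEq V] [Fintype E] [DecidableEq E]
    (ends : E → Sym2 V) (p : E → R), IsProbVec p →
    ∀ (s : V) (T : Finset V) (a b u w : V), s ∉ T → u ∉ T → u ≠ s → w ∉ T → w ≠ s →
      LinDRow p ends s T a b u w

end Closure

end LinD

end Summit.Ventures.PercRepro2
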